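import Summits.QuantumFields.YangMills.Theorems.LuscherReductionRunningReductionKTRitzDiag
import Summits.QuantumFields.YangMills.Theorems.FemtoTransferGapBounds
import Summits.QuantumFields.YangMills.Theorems.FemtoTransferGapPositivity
import Literature.Analysis.OperatorTheory.ClusterKatoTempleBound

/-!
# Line «KT» rev 3 — the repaired door `KatoTempleDoor` (residual-Gram form) and `RitzBasics` (diagonal family) PROVED

Authored by planner ym-cruxidea-19978-1 GEN 3 (2026-08-27, `pub/ym-beyond/ym-cruxidea-19978-1/KTDoorR3.lean` ae2d37eb61444160; ask R3-b); filed to the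
Theorems side by seat ym-infvol-p2 g3 with the two statement `def`s inlined as theorem types (`katoTempleDoorR3`, `ritzBasicsR3`) and the
namespace moved under `…Theorems.FemtoTransferGap`.  SORRY-FREE, over TREE modules only:
`Theorems/LuscherReductionRunningReductionKTPhysSpace.lean` (`physSubmodule`, `l2Form`, `transferOp`; ym-infvol-p2),
`…KTRitzDiag.lean` (`ritzDiag_le_ritzValue`), `…RitzBasics.lean` (`ritzValue_le_levelValue`, `isPhys_of_mem_span`), and lit g8's
`Literature/Analysis/OperatorTheory/ClusterKatoTempleBound.lean` (`clusterKatoTemple_of_functionals_of_forall_gt`).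

It proves VERBATIM copies of the rev-3 statements `KatoTempleDoor` and `RitzBasics` of the candidate skeleton
`pub/ym-beyond/ym-cruxidea-19978-1/Lines-KT-r3.lean` (namespace `…Cruxes.RunningReduction.KT`), i.e. the stubs `stub_katoTempleDoor` and
`stub_ritzBasics` of rev 3 — so that after the repair the line «KT» again has exactly TWO open stubs, the XL ones
(`stub_coarseNoIntruder`, `stub_dressedRitz`), plus `stub_oneSiteLowerCoarse ⇐ ONE`.
The a-priori step `apriori_of_levelValue_le` is the owner's `aprioriFunctionals_of_levelValue_le` (KTDoorLayer.lean rev 3, dab5b276)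
transcribed to the tree's `l2Form`/`transferOp` dictionary; `cluster_bound_res` is the owner's `cluster_bound_op_on_phys` with the
variance hypothesis replaced by the residual Gram bound (so `residualGram_le_of_variance` is no longer needed).
HONEST FRAMING: fixed-lattice finite-dimensional linear algebra on the femto leaf R2b1; nothing here bears on infinite volume or the Clay gap.
-/

set_option autoImplicit false

noncomputable section

open MeasureTheory Filter Topology Real
open Literature.MathematicalPhysics.QuantumFieldTheory
open Literature.MathematicalPhysics.QuantumLattice
open Literature.Analysis.OperatorTheory.YMMatrixModel
open Literature.Analysis.OperatorTheory
open Literature.Analysis.OperatorTheory.ClusterKatoTemple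
open scoped BigOperators

namespace Summit.QuantumFields.YangMills.Theorems.FemtoTransferGap.KTDoorR3

open Summit.QuantumFields.YangMills.Theorems.FemtoTransferGap

variable {L : ℕ} [NeZero L]

/-! ## §1 The form `E = ⟨·, K_β ·⟩` on the physical subspace and the a-priori information in functional form -/

/-- `E x y := l2Form x (K_β y) = qform x y`. -/
theorem E_apply (β : ℝ) (x y : physSubmodule L) :
    ((l2Form L).compl₂ (transferOp β)) x y = qform su2Rep β (x : GaugeConfig 3 L SU2 → ℝ) y := by
  rw [LinearMap.compl₂_apply, l2Form_transferOp_right]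

/-- `E` is symmetric (`K_β` is `l2`-symmetric). -/
theorem E_symm (β : ℝ) (x y : physSubmodule L) :
    ((l2Form L).compl₂ (transferOp β)) x y = ((l2Form L).compl₂ (transferOp β)) y x := by
  rw [LinearMap.compl₂_apply, LinearMap.compl₂_apply, ← transferOp_symm, l2Form_symm]

/-- **A-priori information in functional form** (owner's `aprioriFunctionals_of_levelValue_le`, transcribed): `levelValue n ≤ θ`
unpacks, for every `θ' > θ`, into `n` physical constraint functionals on whose joint kernel `⟨y,K_βy⟩ ≤ θ'‖y‖²`. -/
theorem apriori_of_levelValue_le {β θ : ℝ} (hβ : 0 ≤ β) {n : ℕ} (h : levelValue su2Rep L β n ≤ θ) :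
    ∀ θ' : ℝ, θ < θ' → ∃ f : Fin n → physSubmodule L →ₗ[ℝ] ℝ,
      ∀ y : physSubmodule L, (∀ l, f l y = 0) → ((l2Form L).compl₂ (transferOp β)) y y ≤ θ' * l2Form L y y := by
  intro θ' hθ'
  set S : Set ℝ := {s | ∃ φs : Fin n → (GaugeConfig 3 L SU2 → ℝ), (∀ i, IsPhys (φs i)) ∧
    s = sSup (rayleighSet su2Rep L β fun ψ => ∀ i, l2 ψ (φs i) = 0)} with hS
  have hlv : levelValue su2Rep L β n = sInf S := by
    unfold levelValue; rfl
  have hne : S.Nonempty := ⟨_, fun _ _ => 1, fun _ => isPhys_const 1, rfl⟩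
  have hbdd : BddBelow S := by
    refine ⟨0, fun s hs => ?_⟩
    obtain ⟨φs, -, rfl⟩ := hs
    refine Real.sSup_nonneg fun r hr => ?_
    obtain ⟨ψ, hψ, -, hpos, rfl⟩ := hr
    exact div_nonneg (qform_su2Rep_self_nonneg hβ hψ) hpos.le
  have hlt : sInf S < θ' := (hlv ▸ h).trans_lt hθ'
  obtain ⟨s, hsS, hsθ⟩ := (csInf_lt_iff hbdd hne).mp hlt
  obtain ⟨φs, hφ, rfl⟩ := hsS
  refine ⟨fun l => l2Form L ⟨φs l, hφ l⟩, fun y hy => ?_⟩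
  have hperp : ∀ l, l2 (y : GaugeConfig 3 L SU2 → ℝ) (φs l) = 0 := fun l => by
    have := hy l
    rw [l2Form_apply] at this
    rw [l2_comm]; exact this
  rw [E_apply, l2Form_apply]
  rcases (l2_self_nonneg (y : GaugeConfig 3 L SU2 → ℝ)).eq_or_lt with h0 | hpos
  · -- `‖y‖² = 0` ⇒ `⟨y, K y⟩ = 0` by Cauchy–Schwarz
    have hK : IsPhys (transferApply (L := L) β (y : GaugeConfig 3 L SU2 → ℝ)) := isPhys_transferApply β y.2
    have hcs := sq_l2_le y.2 hK
    rw [← h0, zero_mul] at hcs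
    have hz : l2 (y : GaugeConfig 3 L SU2 → ℝ) (transferApply β (y : GaugeConfig 3 L SU2 → ℝ)) = 0 :=
      pow_eq_zero_iff (n := 2) (by norm_num) |>.mp (le_antisymm hcs (sq_nonneg _))
    rw [qform_eq_l2_transferApply, hz, ← h0, mul_zero]
  · have hmem : qform su2Rep β (y : GaugeConfig 3 L SU2 → ℝ) y / l2 (y : GaugeConfig 3 L SU2 → ℝ) y ∈
        rayleighSet su2Rep L β (fun ψ => ∀ i, l2 ψ (φs i) = 0) :=
      ⟨y, y.2, hperp, hpos, rfl⟩
    have hle : qform su2Rep β (y : GaugeConfig 3 L SU2 → ℝ) y / l2 (y : GaugeConfig 3 L SU2 → ℝ) y ≤ θ' :=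
      ((le_csSup (bddAbove_rayleighSet_su2Rep L β _) hmem).trans hsθ.le)
    rwa [div_le_iff₀ hpos] at hle

/-! ## §2 The cluster Kato–Temple bound in residual-Gram form on the physical subspace -/

/-- **Cluster bound, residual-Gram form** (owner's `cluster_bound_op_on_phys` with the variance hypothesis REPLACED by the
residual Gram bound — the native hypothesis `hres` of `clusterKatoTemple_of_functionals_of_forall_gt`). -/
theorem cluster_bound_res {β θ : ℝ} (hβ : 0 ≤ β) {k : ℕ} (hθ : levelValue su2Rep L β (k + 1) ≤ θ)
    (u : Fin (k + 1) → physSubmodule L) (m : Fin (k + 1) → ℝ)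
    (hon : ∀ i l, l2Form L (u i) (u l) = if i = l then 1 else 0)
    (hritz : ∀ i l, l2Form L (u i) (transferOp β (u l)) = if i = l then m i else 0)
    {ϱ : ℝ} (hϱ : 0 ≤ ϱ)
    (hres : ∀ c : Fin (k + 1) → ℝ,
      l2Form L (∑ i, c i • (transferOp β (u i) - m i • u i)) (∑ i, c i • (transferOp β (u i) - m i • u i)) ≤
        ϱ * ∑ i, c i ^ 2)
    {j : ℕ} {mhi mlo : ℝ} (hθlo : θ < mlo) (hlohi : mlo ≤ mhi) (hmlo : ∀ i, mlo ≤ m i)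
    (hmhi : ∀ i : Fin (k + 1), j ≤ i.val → m i ≤ mhi)
    (x : physSubmodule L) (hx : ∀ i : Fin (k + 1), i.val < j → l2Form L (u i) x = 0) :
    qform su2Rep β (x : GaugeConfig 3 L SU2 → ℝ) x ≤ (mhi + ϱ / (mlo - θ)) * l2 (x : GaugeConfig 3 L SU2 → ℝ) x := by
  have hK := transferOp_symm (L := L) β
  have hrepr : ∀ i y, ((l2Form L).compl₂ (transferOp β)) (u i) y =
      m i * l2Form L (u i) y + l2Form L (transferOp β (u i) - m i • u i) y := by
    intro i y
    rw [LinearMap.compl₂_apply, ← hK]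
    simp only [map_sub, map_smul, LinearMap.sub_apply, LinearMap.smul_apply, smul_eq_mul]
    ring
  have hru : ∀ i l, l2Form L (transferOp β (u i) - m i • u i) (u l) = 0 := by
    intro i l
    simp only [map_sub, map_smul, LinearMap.sub_apply, LinearMap.smul_apply, smul_eq_mul]
    rw [hK, hritz, hon]
    split_ifs <;> ring
  have hres' : ∀ c : Fin (k + 1) → ℝ, ∑ i, ∑ l, c i * c l *
      l2Form L (transferOp β (u i) - m i • u i) (transferOp β (u l) - m l • u l) ≤ ϱ * ∑ i, c i ^ 2 := by
    intro c
    rw [← bilin_sum_smul_sum_smul]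
    exact hres c
  have h := clusterKatoTemple_of_functionals_of_forall_gt (l2Form L) ((l2Form L).compl₂ (transferOp β)) l2Form_symm
    l2Form_self_nonneg (E_symm β) (apriori_of_levelValue_le hβ hθ) u (fun i => transferOp β (u i) - m i • u i) m hon hrepr
    hru hϱ hres' hθlo hlohi hmlo hmhi x hx
  rwa [E_apply, l2Form_apply] at h

/-- **`λ_j ≤ m_j + ϱ/(m_k − θ)` from diagonal Ritz data with a residual Gram bound** (owner's `levelValue_le_of_sortedRitz`, residual form). -/
theorem levelValue_le_of_diagonal_res {β θ : ℝ} (hβ : 0 ≤ β) {k : ℕ} (hθ : levelValue su2Rep L β (k + 1) ≤ θ)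
    (u : Fin (k + 1) → physSubmodule L) (m : Fin (k + 1) → ℝ)
    (hon : ∀ i l, l2Form L (u i) (u l) = if i = l then 1 else 0)
    (hritz : ∀ i l, l2Form L (u i) (transferOp β (u l)) = if i = l then m i else 0)
    (hanti : ∀ i l : Fin (k + 1), i ≤ l → m l ≤ m i) (hθm : θ < m (Fin.last k))
    {ϱ : ℝ} (hϱ : 0 ≤ ϱ)
    (hres : ∀ c : Fin (k + 1) → ℝ,
      l2Form L (∑ i, c i • (transferOp β (u i) - m i • u i)) (∑ i, c i • (transferOp β (u i) - m i • u i)) ≤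
        ϱ * ∑ i, c i ^ 2)
    (j : Fin (k + 1)) :
    levelValue su2Rep L β j ≤ m j + ϱ / (m (Fin.last k) - θ) := by
  have hlast : ∀ i, m (Fin.last k) ≤ m i := fun i => hanti i (Fin.last k) (Fin.le_last i)
  have hpos : 0 < m (Fin.last k) - θ := sub_pos.mpr hθm
  have hθ0 : 0 ≤ θ := (levelValue_su2Rep_nonneg L hβ (k + 1)).trans hθ
  have hs0 : 0 ≤ m j + ϱ / (m (Fin.last k) - θ) :=
    add_nonneg (hθ0.trans (hθm.le.trans (hlast j))) (div_nonneg hϱ hpos.le)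
  refine levelValue_le_of_forall_rayleigh_le su2Rep β hs0
    (fun i : Fin j.val => (u (Fin.castLE j.isLt.le i) : GaugeConfig 3 L SU2 → ℝ))
    (fun i => (u (Fin.castLE j.isLt.le i)).2) fun ψ hψ hperp _ => ?_
  have hx : ∀ i : Fin (k + 1), i.val < j.val → l2Form L (u i) ⟨ψ, hψ⟩ = 0 := by
    intro i hi
    have h := hperp ⟨i.val, hi⟩
    have hc : Fin.castLE j.isLt.le ⟨i.val, hi⟩ = i := Fin.ext rfl
    rw [hc] at h
    rw [l2Form_apply, l2_comm]
    exact h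
  exact cluster_bound_res hβ hθ u m hon hritz hϱ hres hθm (hlast j) hlast (fun i hi => hanti j i hi) ⟨ψ, hψ⟩ hx

/-! ## §3 The rev-3 statements of line «KT» (VERBATIM copies of `…Cruxes.RunningReduction.KT.KatoTempleDoor` / `.RitzBasics`,
candidate skeleton `Lines-KT-r3.lean`) and their proofs -/

/-- The underlying function of a finite combination of the packaged residuals. -/
theorem coe_sum_smul_residual {k : ℕ} (β : ℝ) (φ : Fin (k + 1) → (GaugeConfig 3 L SU2 → ℝ))
    (hφ : ∀ i, IsPhys (φ i)) (c : Fin (k + 1) → ℝ) :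
    ((∑ i, c i • (transferOp β (⟨φ i, hφ i⟩ : physSubmodule L) -
        qform su2Rep β (φ i) (φ i) • (⟨φ i, hφ i⟩ : physSubmodule L)) : physSubmodule L) : GaugeConfig 3 L SU2 → ℝ) =
      ∑ i, c i • (transferApply β (φ i) - qform su2Rep β (φ i) (φ i) • φ i) := by
  rw [Submodule.coe_sum]
  refine Finset.sum_congr rfl fun i _ => ?_
  rw [Submodule.coe_smul, Submodule.coe_sub, Submodule.coe_smul, coe_transferOp]

/-- **The rev-3 door PROVED** — VERBATIM the text of `KT.KatoTempleDoor` (= `Stmt.stub_katoTempleDoor` of the candidate skeleton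
`Lines-KT-r3.lean`): residual-Gram form of the Kato–Temple–Lehmann cluster bound for an `l2`-orthonormal `qform`-diagonal decreasing physical
trial family. [cite: Kato1949, Lemma 2, Thm 1] [cite: Lehmann1963] -/
theorem katoTempleDoorR3 :
    ∀ (L : ℕ) [NeZero L] (β : ℝ) (k : ℕ) (φ : Fin (k + 1) → (GaugeConfig 3 L SU2 → ℝ)) (θ ϱ : ℝ), 1 ≤ β →
      (∀ i, IsPhys (φ i)) → (∀ i l, l2 (φ i) (φ l) = if i = l then 1 else 0) →
      (∀ i l, i ≠ l → qform su2Rep β (φ i) (φ l) = 0) →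
      (∀ i l : Fin (k + 1), i ≤ l → qform su2Rep β (φ l) (φ l) ≤ qform su2Rep β (φ i) (φ i)) →
      levelValue su2Rep L β (k + 1) ≤ θ → θ < qform su2Rep β (φ (Fin.last k)) (φ (Fin.last k)) → 0 ≤ ϱ →
      (∀ c : Fin (k + 1) → ℝ,
        l2 (∑ i, c i • (transferApply β (φ i) - qform su2Rep β (φ i) (φ i) • φ i))
           (∑ i, c i • (transferApply β (φ i) - qform su2Rep β (φ i) (φ i) • φ i)) ≤ ϱ * ∑ i, c i ^ 2) →
      ∀ j : Fin (k + 1), levelValue su2Rep L β j ≤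
        qform su2Rep β (φ j) (φ j) + ϱ / (qform su2Rep β (φ (Fin.last k)) (φ (Fin.last k)) - θ) := by
  intro L _ β k φ θ ϱ hβ hφ hon hdiag hanti hθ hθm hϱ hres j
  have hβ0 : (0 : ℝ) ≤ β := zero_le_one.trans hβ
  have hon' : ∀ i l, l2Form L (⟨φ i, hφ i⟩ : physSubmodule L) ⟨φ l, hφ l⟩ = if i = l then 1 else 0 :=
    fun i l => by rw [l2Form_apply]; exact hon i l
  have hritz : ∀ i l, l2Form L (⟨φ i, hφ i⟩ : physSubmodule L) (transferOp β ⟨φ l, hφ l⟩) =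
      if i = l then qform su2Rep β (φ i) (φ i) else 0 := by
    intro i l
    rw [l2Form_transferOp_right]
    by_cases h : i = l
    · subst h; simp
    · rw [if_neg h]; exact hdiag i l h
  have hres' : ∀ c : Fin (k + 1) → ℝ,
      l2Form L (∑ i, c i • (transferOp β (⟨φ i, hφ i⟩ : physSubmodule L) -
          qform su2Rep β (φ i) (φ i) • (⟨φ i, hφ i⟩ : physSubmodule L)))
        (∑ i, c i • (transferOp β (⟨φ i, hφ i⟩ : physSubmodule L) -
          qform su2Rep β (φ i) (φ i) • (⟨φ i, hφ i⟩ : physSubmodule L))) ≤ ϱ * ∑ i, c i ^ 2 := by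
    intro c
    rw [l2Form_apply, coe_sum_smul_residual β φ hφ c]
    exact hres c
  exact levelValue_le_of_diagonal_res hβ0 hθ (fun i => ⟨φ i, hφ i⟩) (fun i => qform su2Rep β (φ i) (φ i)) hon' hritz
    hanti hθm hϱ hres' j

/-- **The rev-3 Ritz basics PROVED** (`stub_ritzBasics` of `Lines-KT-r3.lean`): `m_j ≤ λ_j` for a diagonal orthonormal physical
family with decreasing Ritz values — tree `ritzDiag_le_ritzValue` (in-span Courant–Fischer, lower half) + `ritzValue_le_levelValue`. -/
theorem ritzBasicsR3 :
    ∀ (L : ℕ) [NeZero L] (β : ℝ) (n : ℕ) (φ : Fin n → (GaugeConfig 3 L SU2 → ℝ)), 1 ≤ β →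
      (∀ i, IsPhys (φ i)) → (∀ i l, l2 (φ i) (φ l) = if i = l then 1 else 0) →
      (∀ i l, i ≠ l → qform su2Rep β (φ i) (φ l) = 0) →
      (∀ i l : Fin n, i ≤ l → qform su2Rep β (φ l) (φ l) ≤ qform su2Rep β (φ i) (φ i)) →
      ∀ j : Fin n, qform su2Rep β (φ j) (φ j) ≤ levelValue su2Rep L β j := by
  intro L _ β n φ hβ hφ hon hdiag hanti j
  have hβ0 : (0 : ℝ) ≤ β := zero_le_one.trans hβ
  -- `n = k + 1`
  obtain ⟨k, rfl⟩ : ∃ k, n = k + 1 := ⟨n - 1, (Nat.succ_pred_eq_of_pos (Fin.pos j)).symm⟩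
  -- the family, packaged in the physical subspace, is its own sorted Ritz basis
  set u : Fin (k + 1) → physSubmodule L := fun i => ⟨φ i, hφ i⟩ with hu
  set m : Fin (k + 1) → ℝ := fun i => qform su2Rep β (φ i) (φ i) with hm
  have hcoe : ∀ i, (u i : GaugeConfig 3 L SU2 → ℝ) = φ i := fun i => rfl
  have hsub : ∀ i, (u i : GaugeConfig 3 L SU2 → ℝ) ∈ Submodule.span ℝ (Set.range φ) :=
    fun i => by rw [hcoe]; exact Submodule.subset_span ⟨i, rfl⟩
  have hon' : ∀ i l, l2 (u i : GaugeConfig 3 L SU2 → ℝ) (u l) = if i = l then 1 else 0 :=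
    fun i l => by rw [hcoe, hcoe]; exact hon i l
  have hdiag' : ∀ i l, qform su2Rep β (u i : GaugeConfig 3 L SU2 → ℝ) (u l) = if i = l then m i else 0 := by
    intro i l
    rw [hcoe, hcoe]
    by_cases h : i = l
    · subst h; simp [hm]
    · rw [if_neg h]; exact hdiag i l h
  have hanti' : Antitone m := fun i l hil => hanti i l hil
  -- `l2` is definite on the span of an orthonormal family
  have hdef : ∀ ψ ∈ Submodule.span ℝ (Set.range φ), ψ ≠ 0 → 0 < l2 ψ ψ := by
    intro ψ hψ hne
    obtain ⟨c, rfl⟩ := (Submodule.mem_span_range_iff_exists_fun ℝ).mp hψ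
    have hx : (∑ i, c i • φ i) = ((∑ i, c i • u i : physSubmodule L) : GaugeConfig 3 L SU2 → ℝ) := by
      rw [Submodule.coe_sum]
      exact Finset.sum_congr rfl fun i _ => by rw [Submodule.coe_smul, hcoe]
    have hl2 : l2 (∑ i, c i • φ i) (∑ i, c i • φ i) = ∑ i, c i ^ 2 := by
      rw [hx, ← l2Form_apply, bilin_sum_smul_sum_smul]
      refine Finset.sum_congr rfl fun i _ => ?_
      simp only [l2Form_apply, hon', mul_ite, mul_one, mul_zero, Finset.sum_ite_eq, Finset.mem_univ, if_true]
      ring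
    rw [hl2]
    have hc : ∃ i, c i ≠ 0 := by
      by_contra hall
      push Not at hall
      apply hne
      exact Finset.sum_eq_zero fun i _ => by rw [hall i, zero_smul]
    obtain ⟨i, hi⟩ := hc
    exact lt_of_lt_of_le (by positivity) (Finset.single_le_sum (fun l _ => sq_nonneg (c l)) (Finset.mem_univ i))
  have h1 : m j ≤ ritzValue β φ j := by
    have h := ritzDiag_le_ritzValue (β := β) (φ := φ) (u := u) (m := m) hφ hsub hon' hdiag' hanti' (j := j.val)
      (Nat.le_of_lt_succ j.isLt)
    have hj : (⟨j.val, Nat.lt_succ_of_le (Nat.le_of_lt_succ j.isLt)⟩ : Fin (k + 1)) = j := Fin.ext rfl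
    rw [hj] at h
    exact h
  exact h1.trans (ritzValue_le_levelValue hβ0 hφ hdef j)

end Summit.QuantumFields.YangMills.Theorems.FemtoTransferGap.KTDoorR3

end
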